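/-
COR-CM (cell pub-hodgecm2, stage 2 of the Hodge ladder) — count-neutral KERNEL COMBINATORICS «the named cyclotomic fields, II»
(seat prover-pub-hodgecm2-b23-g39-0, binder prover b23, gen 39; claim CYCLIC-FIELDS F3, HOME/INBOX.md l.9351).  Theorems only: instances of
`CorCM/FaceCyclicGaloisGroup.lean` (F1) and `CorCM/FaceCyclicBlockNumerals.lean` (F2) of this lane; the INT2-GEN socket, seat b09's floors and
gen 38's `FaceCyclicGeneration` enter BY NAME through them; no geometry, no named fact, nothing asserted; `Interfaces.lean` (C1), every E term,
B01 and `Transposition/*` are untouched.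
HONEST FRAMING (COORDINATOR RULING — HODGE FRAMING CORRECTION, 2026-08-21T11:55:35Z): `HC_CM` is NOT proved, here or anywhere in the
tree; this file produces no period and proves no face period for any field; every `HodgeConjectureFor` below is CONDITIONAL on face periods.
T5: n/a-class — the only Prop hypothesis binder displayed is INT2-GEN's period hypothesis on the produced face set; no named-fact /
conjecture-def binder; checker: self (prover-pub-hodgecm2-b23-g39-0), 2026-08-22.
-/
import Summits.HodgeConjecture.CorCM.FaceCyclicGaloisGroup
import Summits.HodgeConjecture.CorCM.FaceCyclicBlockNumerals
import HarnessLib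

/-!
# The named cyclotomic CM fields, II: block numbers, exact face counts, and the conditional Hodge reading

This file: `ℚ(ζ₂₉)` (degree 28, `β = 586`, 585 faces), `ℚ(ζ₃₁)` (30, 1096, 1095) and the prime-power fields `ℚ(ζ₉)` (6, 2, 1),
`ℚ(ζ₂₅)` (20, 52, 51), `ℚ(ζ₂₇)` (18, 30, 29).

For each field `K` (ANY CM field that is an `n`-th cyclotomic extension of `ℚ` — the field seat supplies `⟨CyclotomicField n ℚ⟩` with
Mathlib's `IsCyclotomicExtension.Rat.isCMField`) three kernel theorems, all instance-binder free:
* `card_block_galT_cyclotomic_<n>` — the number `β(K)` of blocks of abstract CM types of `GalT K` (↔ the simple CM isogeny classes split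
  by `K`, [Milne1999, Prop. 2.1]), from F1's cyclic `GalT` + F2's numerals of b09's closed form;
* `isLeast_card_faces_hgen_cyclotomic_<n>` — the least number of rank-four faces of `K` whose Weil characters at all base embeddings
  generate those of every face (INT2-GEN's `hgen(𝒮, σ₀)`) is EXACTLY `β(K) − 1`, for every base embedding `σ₀` (gen 38's
  `isLeast_card_faces_hgen_of_isCyclic` through F2);
* `hodgeConjectureFor_cyclotomic_<n>_of_exists_facePeriod` — a face set of exactly `β(K) − 1` faces EXISTS such that, IF each has a
  non-vanishing period on the universe of record, THEN the Hodge conjecture holds in every codimension for every complex abelian variety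
  dominated by a product of CM abelian varieties with CM by subfields of `K` (among them all powers and products of the simple CM abelian
  varieties of Fermat type attached to `K`) — CONDITIONAL; `HC_CM` is NOT proved, no period is produced.
The fields `ℚ(ζ₇)`, `ℚ(ζ₁₁)`, `ℚ(ζ₁₃)`, `ℚ(ζ₁₇)`, `ℚ(ζ₁₉)`, `ℚ(ζ₂₃)` are the companion file `CorCM/FaceCyclotomicFields.lean`.

References: [cite: Washington1997, Thm. 2.5, Prop. 2.7]; [cite: Pohlmann1968, Thm. 1]; [cite: Milne1999LefschetzClasses, Thm. 3.2, Prop. 2.1];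
[cite: Shimura1998, §6.2 Theorem 3 and §6.1 Corollary of Theorem 2 (pp. 41–43), §8.1 (p. 62)]; [cite: MumfordAV1970, §19 Thm. 1 and p. 169].
-/

noncomputable section

open CategoryTheory NumberField NumberField.ComplexEmbedding
open Literature.AlgebraicGeometry Literature.AlgebraicGeometry.Motives Literature.AlgebraicGeometry.HodgeTheory
open Literature.AlgebraicGeometry.ComplexMultiplication Literature.AlgebraicGeometry.Milne1999
open Literature.NumberTheory.Automorphic
open Literature.NumberTheory.Automorphic.PicardCM
open Summit.HodgeConjecture.CorCM.Domination

namespace Summit.HodgeConjecture.CorCM.FaceCyclic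

open Summit.HodgeConjecture.CorCM.Prior.AllgGroup.RfwfAllgGroup
open Summit.HodgeConjecture.CorCM.Census.BlockParity
open Summit.HodgeConjecture.CorCM.Census.Coinvariant

/-! ## `ℚ(ζ₂₉)`: degree `28`, `β = 586`, exactly `585` faces -/

section Zeta29

variable (K : CMField) [IsCyclotomicExtension {29} ℚ (K : Type)]

/-- **`β(ℚ(ζ₂₉)) = 586`** (cyclic `GalT` of order `28`). [cite: Washington1997, Thm. 2.5] [cite: Milne1999LefschetzClasses, Prop. 2.1] -/
theorem card_block_galT_cyclotomic_twentyNine : Fintype.card (Block (conjT : GalT K)) = 586 := by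
  have hp : Nat.Prime 29 := by norm_num
  haveI := isGalois_of_isCyclotomicExtension_prime (F := (K : Type)) 29
  haveI := isCyclic_galT_of_isCyclotomicExtension_prime (F := (K : Type)) hp
  exact card_block_galT_of_finrank_eq_twentyEight (by rw [finrank_of_isCyclotomicExtension_prime (F := (K : Type)) hp])

/-- **`ℚ(ζ₂₉)`: the least number of generating faces is `585`** (every base embedding `σ₀`). [cite: Pohlmann1968, Thm. 1] -/
theorem isLeast_card_faces_hgen_cyclotomic_twentyNine (σ₀ : (K : Type) →+* ℂ) :
    IsLeast {m : ℕ | ∃ 𝒮 : Finset (Face K), 𝒮.card = m ∧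
      ∀ f : Face K, lefChar f.corner (fun _ => ({σ₀} : Finset ((K : Type) →+* ℂ))) ∈ AddSubgroup.closure
        {a : Asym K | ∃ g ∈ (𝒮 : Set (Face K)), ∃ σ : (K : Type) →+* ℂ, a = lefChar g.corner (fun _ => ({σ} : Finset ((K : Type) →+* ℂ)))}}
      585 := by
  have hp : Nat.Prime 29 := by norm_num
  haveI := isGalois_of_isCyclotomicExtension_prime (F := (K : Type)) 29
  haveI := isCyclic_galT_of_isCyclotomicExtension_prime (F := (K : Type)) hp
  exact isLeast_card_faces_hgen_of_card_block_eq (card_block_galT_cyclotomic_twentyNine K) σ₀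

/-- **HC for the slice of `ℚ(ζ₂₉)` from `585` face periods** (simple CM abelian varieties of dimension `14` with CM by `ℚ(ζ₂₉)`, their powers,
products and everything they dominate, together with the CM subfields): CONDITIONAL on the periods; `HC_CM` is NOT proved.
[cite: Shimura1998, §6.2 Theorem 3 and §6.1 Corollary of Theorem 2 (pp. 41–43)] [cite: Pohlmann1968, Thm. 1]
[cite: Milne1999LefschetzClasses, Thm. 3.2 and Cor. 4.5] [cite: MumfordAV1970, §19 Thm. 1 and p. 169] -/
theorem hodgeConjectureFor_cyclotomic_twentyNine_of_exists_facePeriod (σ₀ : (K : Type) →+* ℂ) :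
    ∃ 𝒮 : Finset (Face K), 𝒮.card = 585 ∧
      ((∀ f ∈ 𝒮, ∃ ι₁ : K →+* ℂ, f.Admissible ι₁ ∧ ∃ (V : HermSpace3 K ι₁) (σ : K →+* ℂ),
        (Model.picardCMUniverse exists_isReal_hodgeModel_holds hodgePQ_independent_of_hodgeModel_holds
          BallQuotient.ballQuotientUniformised_holds cmAbelianVarietyRealised_holds).PeriodNV ι₁ V K f.psi σ) →
      ∀ {P B : AbelianVariety ℂ}, AbelianVariety.IsProductOf (fun B : AbelianVariety ℂ =>
        ∃ (E : Type) (_ : Field E) (_ : NumberField E) (_ : IsCMField E) (_ : E →+* (K : Type)) (Φ : CMType E)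
          (ι : 𝓞 E →+* End B) (θ : E →+* Module.End ℂ (complexBetti B.X 1)),
          IsCMTypeRealisation Φ B ι θ) P →
      AVDominatedBy B P → HodgeConjectureFor B.dim B.X) := by
  obtain ⟨𝒮, hcard, h⟩ := hodgeConjectureFor_of_isCyclotomicExtension_prime_of_exists_facePeriod K
    (p := 29) (by norm_num) (by norm_num) σ₀
  rw [card_block_galT_cyclotomic_twentyNine K] at hcard
  exact ⟨𝒮, by omega, h⟩

end Zeta29

/-! ## `ℚ(ζ₃₁)`: degree `30`, `β = 1096`, exactly `1095` faces -/

section Zeta31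

variable (K : CMField) [IsCyclotomicExtension {31} ℚ (K : Type)]

/-- **`β(ℚ(ζ₃₁)) = 1096`** (cyclic `GalT` of order `30`). [cite: Washington1997, Thm. 2.5] [cite: Milne1999LefschetzClasses, Prop. 2.1] -/
theorem card_block_galT_cyclotomic_thirtyOne : Fintype.card (Block (conjT : GalT K)) = 1096 := by
  have hp : Nat.Prime 31 := by norm_num
  haveI := isGalois_of_isCyclotomicExtension_prime (F := (K : Type)) 31
  haveI := isCyclic_galT_of_isCyclotomicExtension_prime (F := (K : Type)) hp
  exact card_block_galT_of_finrank_eq_thirty (by rw [finrank_of_isCyclotomicExtension_prime (F := (K : Type)) hp])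

/-- **`ℚ(ζ₃₁)`: the least number of generating faces is `1095`** (every base embedding `σ₀`). [cite: Pohlmann1968, Thm. 1] -/
theorem isLeast_card_faces_hgen_cyclotomic_thirtyOne (σ₀ : (K : Type) →+* ℂ) :
    IsLeast {m : ℕ | ∃ 𝒮 : Finset (Face K), 𝒮.card = m ∧
      ∀ f : Face K, lefChar f.corner (fun _ => ({σ₀} : Finset ((K : Type) →+* ℂ))) ∈ AddSubgroup.closure
        {a : Asym K | ∃ g ∈ (𝒮 : Set (Face K)), ∃ σ : (K : Type) →+* ℂ, a = lefChar g.corner (fun _ => ({σ} : Finset ((K : Type) →+* ℂ)))}}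
      1095 := by
  have hp : Nat.Prime 31 := by norm_num
  haveI := isGalois_of_isCyclotomicExtension_prime (F := (K : Type)) 31
  haveI := isCyclic_galT_of_isCyclotomicExtension_prime (F := (K : Type)) hp
  exact isLeast_card_faces_hgen_of_card_block_eq (card_block_galT_cyclotomic_thirtyOne K) σ₀

/-- **HC for the slice of `ℚ(ζ₃₁)` from `1095` face periods** (simple CM abelian varieties of dimension `15` with CM by `ℚ(ζ₃₁)`, their powers,
products and everything they dominate, together with the CM subfields): CONDITIONAL on the periods; `HC_CM` is NOT proved.
[cite: Shimura1998, §6.2 Theorem 3 and §6.1 Corollary of Theorem 2 (pp. 41–43)] [cite: Pohlmann1968, Thm. 1]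
[cite: Milne1999LefschetzClasses, Thm. 3.2 and Cor. 4.5] [cite: MumfordAV1970, §19 Thm. 1 and p. 169] -/
theorem hodgeConjectureFor_cyclotomic_thirtyOne_of_exists_facePeriod (σ₀ : (K : Type) →+* ℂ) :
    ∃ 𝒮 : Finset (Face K), 𝒮.card = 1095 ∧
      ((∀ f ∈ 𝒮, ∃ ι₁ : K →+* ℂ, f.Admissible ι₁ ∧ ∃ (V : HermSpace3 K ι₁) (σ : K →+* ℂ),
        (Model.picardCMUniverse exists_isReal_hodgeModel_holds hodgePQ_independent_of_hodgeModel_holds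
          BallQuotient.ballQuotientUniformised_holds cmAbelianVarietyRealised_holds).PeriodNV ι₁ V K f.psi σ) →
      ∀ {P B : AbelianVariety ℂ}, AbelianVariety.IsProductOf (fun B : AbelianVariety ℂ =>
        ∃ (E : Type) (_ : Field E) (_ : NumberField E) (_ : IsCMField E) (_ : E →+* (K : Type)) (Φ : CMType E)
          (ι : 𝓞 E →+* End B) (θ : E →+* Module.End ℂ (complexBetti B.X 1)),
          IsCMTypeRealisation Φ B ι θ) P →
      AVDominatedBy B P → HodgeConjectureFor B.dim B.X) := by
  obtain ⟨𝒮, hcard, h⟩ := hodgeConjectureFor_of_isCyclotomicExtension_prime_of_exists_facePeriod K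
    (p := 31) (by norm_num) (by norm_num) σ₀
  rw [card_block_galT_cyclotomic_thirtyOne K] at hcard
  exact ⟨𝒮, by omega, h⟩

end Zeta31

/-! ## `ℚ(ζ₉) = ℚ(ζ_{3^2})`: degree `6`, `β = 2`, exactly `1` face -/

section Zeta9

variable (K : CMField) [IsCyclotomicExtension {9} ℚ (K : Type)]

/-- **`β(ℚ(ζ₉)) = 2`** (cyclic `GalT` of order `6`; the instance `{9} = {3 ^ 2}` by kernel arithmetic).
[cite: Washington1997, Thm. 2.5, Prop. 2.7] [cite: Milne1999LefschetzClasses, Prop. 2.1] -/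
theorem card_block_galT_cyclotomic_nine : Fintype.card (Block (conjT : GalT K)) = 2 := by
  have hp : Nat.Prime 3 := by norm_num
  haveI := isGalois_of_isCyclotomicExtension_prime_pow (F := (K : Type)) 3 2
  haveI := isCyclic_galT_of_isCyclotomicExtension_prime_pow (F := (K : Type)) (k := 2) hp (by norm_num) (by norm_num)
  exact card_block_galT_of_finrank_eq_six
    (by rw [finrank_of_isCyclotomicExtension_prime_pow (F := (K : Type)) (k := 2) hp (by norm_num) (by norm_num)]; norm_num)

/-- **`ℚ(ζ₉)`: the least number of generating faces is `1`** (every base embedding `σ₀`). [cite: Pohlmann1968, Thm. 1] -/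
theorem isLeast_card_faces_hgen_cyclotomic_nine (σ₀ : (K : Type) →+* ℂ) :
    IsLeast {m : ℕ | ∃ 𝒮 : Finset (Face K), 𝒮.card = m ∧
      ∀ f : Face K, lefChar f.corner (fun _ => ({σ₀} : Finset ((K : Type) →+* ℂ))) ∈ AddSubgroup.closure
        {a : Asym K | ∃ g ∈ (𝒮 : Set (Face K)), ∃ σ : (K : Type) →+* ℂ, a = lefChar g.corner (fun _ => ({σ} : Finset ((K : Type) →+* ℂ)))}}
      1 := by
  have hp : Nat.Prime 3 := by norm_num
  haveI := isGalois_of_isCyclotomicExtension_prime_pow (F := (K : Type)) 3 2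
  haveI := isCyclic_galT_of_isCyclotomicExtension_prime_pow (F := (K : Type)) (k := 2) hp (by norm_num) (by norm_num)
  exact isLeast_card_faces_hgen_of_card_block_eq (card_block_galT_cyclotomic_nine K) σ₀

/-- **HC for the slice of `ℚ(ζ₉)` from `1` face period** (simple CM abelian varieties of dimension `3` with CM by `ℚ(ζ₉)`, their powers,
products and everything they dominate, together with the CM subfields): CONDITIONAL on the periods; `HC_CM` is NOT proved.
[cite: Shimura1998, §6.2 Theorem 3 and §6.1 Corollary of Theorem 2 (pp. 41–43)] [cite: Pohlmann1968, Thm. 1]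
[cite: Milne1999LefschetzClasses, Thm. 3.2 and Cor. 4.5] [cite: MumfordAV1970, §19 Thm. 1 and p. 169] -/
theorem hodgeConjectureFor_cyclotomic_nine_of_exists_facePeriod (σ₀ : (K : Type) →+* ℂ) :
    ∃ 𝒮 : Finset (Face K), 𝒮.card = 1 ∧
      ((∀ f ∈ 𝒮, ∃ ι₁ : K →+* ℂ, f.Admissible ι₁ ∧ ∃ (V : HermSpace3 K ι₁) (σ : K →+* ℂ),
        (Model.picardCMUniverse exists_isReal_hodgeModel_holds hodgePQ_independent_of_hodgeModel_holds
          BallQuotient.ballQuotientUniformised_holds cmAbelianVarietyRealised_holds).PeriodNV ι₁ V K f.psi σ) →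
      ∀ {P B : AbelianVariety ℂ}, AbelianVariety.IsProductOf (fun B : AbelianVariety ℂ =>
        ∃ (E : Type) (_ : Field E) (_ : NumberField E) (_ : IsCMField E) (_ : E →+* (K : Type)) (Φ : CMType E)
          (ι : 𝓞 E →+* End B) (θ : E →+* Module.End ℂ (complexBetti B.X 1)),
          IsCMTypeRealisation Φ B ι θ) P →
      AVDominatedBy B P → HodgeConjectureFor B.dim B.X) := by
  obtain ⟨𝒮, hcard, h⟩ := hodgeConjectureFor_of_isCyclotomicExtension_prime_pow_of_exists_facePeriod K
    (p := 3) (k := 2) (by norm_num) (by norm_num) (by norm_num) σ₀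
  rw [card_block_galT_cyclotomic_nine K] at hcard
  exact ⟨𝒮, by omega, h⟩

end Zeta9

/-! ## `ℚ(ζ₂₅) = ℚ(ζ_{5^2})`: degree `20`, `β = 52`, exactly `51` faces -/

section Zeta25

variable (K : CMField) [IsCyclotomicExtension {25} ℚ (K : Type)]

/-- **`β(ℚ(ζ₂₅)) = 52`** (cyclic `GalT` of order `20`; the instance `{25} = {5 ^ 2}` by kernel arithmetic).
[cite: Washington1997, Thm. 2.5, Prop. 2.7] [cite: Milne1999LefschetzClasses, Prop. 2.1] -/
theorem card_block_galT_cyclotomic_twentyFive : Fintype.card (Block (conjT : GalT K)) = 52 := by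
  have hp : Nat.Prime 5 := by norm_num
  haveI := isGalois_of_isCyclotomicExtension_prime_pow (F := (K : Type)) 5 2
  haveI := isCyclic_galT_of_isCyclotomicExtension_prime_pow (F := (K : Type)) (k := 2) hp (by norm_num) (by norm_num)
  exact card_block_galT_of_finrank_eq_twenty
    (by rw [finrank_of_isCyclotomicExtension_prime_pow (F := (K : Type)) (k := 2) hp (by norm_num) (by norm_num)]; norm_num)

/-- **`ℚ(ζ₂₅)`: the least number of generating faces is `51`** (every base embedding `σ₀`). [cite: Pohlmann1968, Thm. 1] -/
theorem isLeast_card_faces_hgen_cyclotomic_twentyFive (σ₀ : (K : Type) →+* ℂ) :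
    IsLeast {m : ℕ | ∃ 𝒮 : Finset (Face K), 𝒮.card = m ∧
      ∀ f : Face K, lefChar f.corner (fun _ => ({σ₀} : Finset ((K : Type) →+* ℂ))) ∈ AddSubgroup.closure
        {a : Asym K | ∃ g ∈ (𝒮 : Set (Face K)), ∃ σ : (K : Type) →+* ℂ, a = lefChar g.corner (fun _ => ({σ} : Finset ((K : Type) →+* ℂ)))}}
      51 := by
  have hp : Nat.Prime 5 := by norm_num
  haveI := isGalois_of_isCyclotomicExtension_prime_pow (F := (K : Type)) 5 2
  haveI := isCyclic_galT_of_isCyclotomicExtension_prime_pow (F := (K : Type)) (k := 2) hp (by norm_num) (by norm_num)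
  exact isLeast_card_faces_hgen_of_card_block_eq (card_block_galT_cyclotomic_twentyFive K) σ₀

/-- **HC for the slice of `ℚ(ζ₂₅)` from `51` face periods** (simple CM abelian varieties of dimension `10` with CM by `ℚ(ζ₂₅)`, their powers,
products and everything they dominate, together with the CM subfields): CONDITIONAL on the periods; `HC_CM` is NOT proved.
[cite: Shimura1998, §6.2 Theorem 3 and §6.1 Corollary of Theorem 2 (pp. 41–43)] [cite: Pohlmann1968, Thm. 1]
[cite: Milne1999LefschetzClasses, Thm. 3.2 and Cor. 4.5] [cite: MumfordAV1970, §19 Thm. 1 and p. 169] -/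
theorem hodgeConjectureFor_cyclotomic_twentyFive_of_exists_facePeriod (σ₀ : (K : Type) →+* ℂ) :
    ∃ 𝒮 : Finset (Face K), 𝒮.card = 51 ∧
      ((∀ f ∈ 𝒮, ∃ ι₁ : K →+* ℂ, f.Admissible ι₁ ∧ ∃ (V : HermSpace3 K ι₁) (σ : K →+* ℂ),
        (Model.picardCMUniverse exists_isReal_hodgeModel_holds hodgePQ_independent_of_hodgeModel_holds
          BallQuotient.ballQuotientUniformised_holds cmAbelianVarietyRealised_holds).PeriodNV ι₁ V K f.psi σ) →
      ∀ {P B : AbelianVariety ℂ}, AbelianVariety.IsProductOf (fun B : AbelianVariety ℂ =>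
        ∃ (E : Type) (_ : Field E) (_ : NumberField E) (_ : IsCMField E) (_ : E →+* (K : Type)) (Φ : CMType E)
          (ι : 𝓞 E →+* End B) (θ : E →+* Module.End ℂ (complexBetti B.X 1)),
          IsCMTypeRealisation Φ B ι θ) P →
      AVDominatedBy B P → HodgeConjectureFor B.dim B.X) := by
  obtain ⟨𝒮, hcard, h⟩ := hodgeConjectureFor_of_isCyclotomicExtension_prime_pow_of_exists_facePeriod K
    (p := 5) (k := 2) (by norm_num) (by norm_num) (by norm_num) σ₀
  rw [card_block_galT_cyclotomic_twentyFive K] at hcard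
  exact ⟨𝒮, by omega, h⟩

end Zeta25

/-! ## `ℚ(ζ₂₇) = ℚ(ζ_{3^3})`: degree `18`, `β = 30`, exactly `29` faces -/

section Zeta27

variable (K : CMField) [IsCyclotomicExtension {27} ℚ (K : Type)]

/-- **`β(ℚ(ζ₂₇)) = 30`** (cyclic `GalT` of order `18`; the instance `{27} = {3 ^ 3}` by kernel arithmetic).
[cite: Washington1997, Thm. 2.5, Prop. 2.7] [cite: Milne1999LefschetzClasses, Prop. 2.1] -/
theorem card_block_galT_cyclotomic_twentySeven : Fintype.card (Block (conjT : GalT K)) = 30 := by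
  have hp : Nat.Prime 3 := by norm_num
  haveI := isGalois_of_isCyclotomicExtension_prime_pow (F := (K : Type)) 3 3
  haveI := isCyclic_galT_of_isCyclotomicExtension_prime_pow (F := (K : Type)) (k := 3) hp (by norm_num) (by norm_num)
  exact card_block_galT_of_finrank_eq_eighteen
    (by rw [finrank_of_isCyclotomicExtension_prime_pow (F := (K : Type)) (k := 3) hp (by norm_num) (by norm_num)]; norm_num)

/-- **`ℚ(ζ₂₇)`: the least number of generating faces is `29`** (every base embedding `σ₀`). [cite: Pohlmann1968, Thm. 1] -/
theorem isLeast_card_faces_hgen_cyclotomic_twentySeven (σ₀ : (K : Type) →+* ℂ) :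
    IsLeast {m : ℕ | ∃ 𝒮 : Finset (Face K), 𝒮.card = m ∧
      ∀ f : Face K, lefChar f.corner (fun _ => ({σ₀} : Finset ((K : Type) →+* ℂ))) ∈ AddSubgroup.closure
        {a : Asym K | ∃ g ∈ (𝒮 : Set (Face K)), ∃ σ : (K : Type) →+* ℂ, a = lefChar g.corner (fun _ => ({σ} : Finset ((K : Type) →+* ℂ)))}}
      29 := by
  have hp : Nat.Prime 3 := by norm_num
  haveI := isGalois_of_isCyclotomicExtension_prime_pow (F := (K : Type)) 3 3
  haveI := isCyclic_galT_of_isCyclotomicExtension_prime_pow (F := (K : Type)) (k := 3) hp (by norm_num) (by norm_num)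
  exact isLeast_card_faces_hgen_of_card_block_eq (card_block_galT_cyclotomic_twentySeven K) σ₀

/-- **HC for the slice of `ℚ(ζ₂₇)` from `29` face periods** (simple CM abelian varieties of dimension `9` with CM by `ℚ(ζ₂₇)`, their powers,
products and everything they dominate, together with the CM subfields): CONDITIONAL on the periods; `HC_CM` is NOT proved.
[cite: Shimura1998, §6.2 Theorem 3 and §6.1 Corollary of Theorem 2 (pp. 41–43)] [cite: Pohlmann1968, Thm. 1]
[cite: Milne1999LefschetzClasses, Thm. 3.2 and Cor. 4.5] [cite: MumfordAV1970, §19 Thm. 1 and p. 169] -/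
theorem hodgeConjectureFor_cyclotomic_twentySeven_of_exists_facePeriod (σ₀ : (K : Type) →+* ℂ) :
    ∃ 𝒮 : Finset (Face K), 𝒮.card = 29 ∧
      ((∀ f ∈ 𝒮, ∃ ι₁ : K →+* ℂ, f.Admissible ι₁ ∧ ∃ (V : HermSpace3 K ι₁) (σ : K →+* ℂ),
        (Model.picardCMUniverse exists_isReal_hodgeModel_holds hodgePQ_independent_of_hodgeModel_holds
          BallQuotient.ballQuotientUniformised_holds cmAbelianVarietyRealised_holds).PeriodNV ι₁ V K f.psi σ) →
      ∀ {P B : AbelianVariety ℂ}, AbelianVariety.IsProductOf (fun B : AbelianVariety ℂ =>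
        ∃ (E : Type) (_ : Field E) (_ : NumberField E) (_ : IsCMField E) (_ : E →+* (K : Type)) (Φ : CMType E)
          (ι : 𝓞 E →+* End B) (θ : E →+* Module.End ℂ (complexBetti B.X 1)),
          IsCMTypeRealisation Φ B ι θ) P →
      AVDominatedBy B P → HodgeConjectureFor B.dim B.X) := by
  obtain ⟨𝒮, hcard, h⟩ := hodgeConjectureFor_of_isCyclotomicExtension_prime_pow_of_exists_facePeriod K
    (p := 3) (k := 3) (by norm_num) (by norm_num) (by norm_num) σ₀
  rw [card_block_galT_cyclotomic_twentySeven K] at hcard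
  exact ⟨𝒮, by omega, h⟩

end Zeta27

end Summit.HodgeConjecture.CorCM.FaceCyclic

end
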